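import Literature.AlgebraicGeometry.Modules.CechLocalizedSectionsAffine
import Literature.AlgebraicGeometry.Modules.TensorStalkPresheaf
import Literature.AlgebraicGeometry.Modules.FiniteTypeLocal
import Mathlib.RingTheory.Localization.BaseChange
import Mathlib.AlgebraicGeometry.AffineScheme
import HarnessLib

/-!
# Sections of the presheaf tensor product over basic opens of an affine open are localizations
# (`M(D(g)) ⊗_{𝒪(D(g))} N(D(g)) = (M(V) ⊗_{𝒪(V)} N(V))_g`; Hartshorne II Prop. 5.2 (b), Stacks 01I8 (1))

Layer `Literature/AlgebraicGeometry/Modules` (0 named facts, no global instances — the auxiliary module structures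
by restriction of scalars are reducible definitions bound with `letI` —, no notation). For two AFFINE-LOCALIZING
(= quasi-coherent, `Modules/QuasicoherentAbelian.isQuasicoherent_iff_isAffineLocalizing`) `𝒪_X`-modules `M`, `N` and
an affine open `V` with ring `A = Γ(V, 𝒪_X)`, the presheaf tensor product `W ↦ M(W) ⊗_{𝒪_X(W)} N(W)`
(`Modules/TensorProductLocallyFree.TSec`, whose sheafification is the tree's `tensorObj M N`, Stacks 01CA) satisfies,
on the basic opens `D(g) ⊆ V`:

  `M(D(g)) ⊗_{A_g} N(D(g))` **is the localization of `M(V) ⊗_A N(V)` at `g`** (`isLocalizedModule_resTₗ`),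

because `M(D(g)) = M(V)_g`, `N(D(g)) = N(V)_g` (Hartshorne II Lemma 5.3, the tree's
`IsAffineLocalizing.isLocalizedModule_basicOpen`), `M(V)_g ⊗_A N(V)_g = (M(V) ⊗_A N(V))_g` (Mathlib's
`IsLocalizedModule S (TensorProduct.map f g)`) and `⊗_{A_g} = ⊗_A` for `A_g`-modules (Mathlib
`IsLocalization.moduleTensorEquiv`). This is the computation behind Hartshorne II Prop. 5.2 (b) "`(M ⊗_A N)~ ≅ M~ ⊗ N~`"
/ The Stacks Project, Tag 01I8 (1): "`Γ(D(f), M~ ⊗ N~) = M_f ⊗_{A_f} N_f = (M ⊗_A N)_f`". Consequently the sections over the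
standard opens `D(g_{k₀} ⋯ g_{k_m})` of a finite family `(g_a)` in `A` form a LOCALIZING SYSTEM in the sense of the
tree's `Algebra/Homology/CechLocalization` (`isSystem_tsec`), to which the degree-zero Čech exactness
`Algebra/Homology/CechLocalizationDegreeZero` (Stacks 00EK) applies: SEPARATION (`tsec_eq_zero_of_forall_resT`) and
GLUING (`exists_tsec_of_compatible`) of presheaf tensors on a standard cover of `V`. The sequel
`Modules/TensorSectionsAffine` turns these into the bijectivity of the sheafification unit
`M(V) ⊗_A N(V) → Γ(V, M ⊗ N)` on affine `V`.

* §1 `tsecModuleOfLE`, `resTₗ` — `M(W) ⊗ N(W)` as an `A`-module for `W ⊆ V` and the `A`-linear restrictions;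
* §2 **`isLocalizedModule_resTₗ`**;
* §3 `sysModule`, `sysι` (over the standard opens `PCech.sysOpen g k = D(g_{k₀} ⋯ g_{k_m})` of
  `Modules/CechLocalizedSectionsAffine`), `isSystem_tsec`, `face_tsec_apply`, `tsec_eq_zero_of_forall_resT`, `exists_tsec_of_compatible`.

Pattern of proof and of statement: the tree's `Modules/CechLocalizedSectionsAffine` (the same argument for the
localized-sections Čech sheaves). Everything is proved; no named fact. Library only (cell `pub-hodge-ring2`,
count-neutral; proves nothing about any crux, route or conjecture).

## References

* R. Hartshorne, *Algebraic Geometry*, GTM 52 (1977), II Lemma 5.3, II Prop. 5.1, II Prop. 5.2 (b) (pp. 110–112). [Hartshorne1977]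
* The Stacks Project, Tag 01I8 (1) (`M~ ⊗ N~ = (M ⊗_R N)~`), Tag 00EK (`0 → M → ⊕ M_{f_i} → ⊕ M_{f_i f_j}`),
  Tag 01CA. [StacksProject]
* U. Görtz, T. Wedhorn, *Algebraic Geometry I*, 2nd ed. (2020), Prop. 7.14 (2) / Cor. 7.19. [GortzWedhorn2020]
-/

noncomputable section

-- `TopCat.Presheaf`/`Scheme.Modules` are not reducible (as in Mathlib's `AlgebraicGeometry/Modules/Sheaf.lean`).
set_option backward.isDefEq.respectTransparency false

open CategoryTheory AlgebraicGeometry Opposite TopologicalSpace MonoidalCategory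
open Literature.Algebra.Homology
open scoped TensorProduct

universe u

namespace Literature.AlgebraicGeometry.Modules

variable {X : Scheme.{u}} (M N : X.Modules) {V : X.Opens}

/-! ### §1 `M(W) ⊗_{𝒪(W)} N(W)` as a `Γ(V, 𝒪_X)`-module for `W ⊆ V`; the linear restriction maps -/

section ModuleOfLE

/-- The native `𝒪_X(W)`-module structure of `M(W) ⊗_{𝒪_X(W)} N(W)`, retyped over `Γ(X, W)` (the scalar ring of
`TSec` is the tree's `secRing X W`, definitionally `Γ(X, W)`; a reducible bridge for instance search, bound with
`letI`). [cite: StacksProject, Tag 01CA] -/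
@[reducible]
def tsecModuleSelf (W : X.Opens) : Module Γ(X, W) (TSec M N W) :=
  inferInstanceAs (Module (secRing X W) (TSec M N W))

/-- The `Γ(V, 𝒪_X)`-module structure on `M(W) ⊗_{𝒪_X(W)} N(W)` for `W ⊆ V`, by restriction of scalars along
`𝒪_X(V) → 𝒪_X(W)` (a reducible definition, bound with `letI`; never a global instance).
[cite: Hartshorne1977, II Prop. 5.2 (p. 110)] -/
@[reducible]
def tsecModuleOfLE {W : X.Opens} (h : W ≤ V) : Module Γ(X, V) (TSec M N W) :=
  letI := tsecModuleSelf M N W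
  Module.compHom (TSec M N W) (X.presheaf.map (homOfLE h).op).hom

/-- The `Γ(V, 𝒪_X)`-action on `M(W) ⊗ N(W)` is through the restriction `r ↦ r|_W`. [cite: Hartshorne1977, II Prop. 5.2 (p. 110)] -/
theorem tsecModuleOfLE_smul_def {W : X.Opens} (h : W ≤ V) (r : Γ(X, V)) (x : TSec M N W) :
    letI := tsecModuleOfLE M N h
    r • x = resRing h r • x := rfl

/-- Transitivity of the restriction of presheaf tensors: `(x|_W)|_Y = x|_Y`. [cite: StacksProject, Tag 01CA] -/
theorem resT_resT {U W Y : X.Opens} (h : W ≤ U) (h' : Y ≤ W) (x : TSec M N U) :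
    resT M N h' (resT M N h x) = resT M N (h'.trans h) x := by
  rw [← resT_eq, ← resT_eq, ← resT_eq]
  change ((tensorPresheaf M N).presheaf.map (homOfLE h).op ≫ (tensorPresheaf M N).presheaf.map (homOfLE h').op) x = _
  rw [← Functor.map_comp]
  rfl

/-- Restriction along `le_rfl` is the identity. [cite: StacksProject, Tag 01CA] -/
theorem resT_self {W : X.Opens} (h : W ≤ W) (x : TSec M N W) : resT M N h x = x := by
  rw [← resT_eq]
  have e : (homOfLE h).op = 𝟙 (op W) := Subsingleton.elim _ _
  rw [e, CategoryTheory.Functor.map_id]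
  rfl

/-- Transported injectivity: restriction of presheaf tensors along an EQUALITY of opens is injective (it is the identity
up to transport). [cite: StacksProject, Tag 01CA] -/
theorem resT_injective_of_eq {W₁ W₂ : X.Opens} (e : W₁ = W₂) :
    Function.Injective (resT M N (le_of_eq e) : TSec M N W₂ → TSec M N W₁) := by
  subst e
  intro x y hxy
  rwa [resT_self, resT_self] at hxy

/-- Transitivity of the restriction of the structure sheaf in the typing of `secRing` (`(r|_W)|_Y = r|_Y`).
[cite: GortzWedhorn2020, (7.1) and (7.4)] -/
theorem resRing_resRing {U W Y : X.Opens} (hW : W ≤ U) (hY : Y ≤ W) (r : secRing X U) :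
    resRing hY (resRing hW r) = resRing (hY.trans hW) r := by
  change ((X.sheaf.obj ⋙ forget₂ CommRingCat RingCat).map (homOfLE hW).op ≫
    (X.sheaf.obj ⋙ forget₂ CommRingCat RingCat).map (homOfLE hY).op) r = _
  rw [← Functor.map_comp]
  rfl

/-- **The restriction `M(V) ⊗ N(V) → M(W) ⊗ N(W)` as a `Γ(V, 𝒪_X)`-linear map**, `W ⊆ V`.
[cite: StacksProject, Tag 01CA] [cite: Hartshorne1977, II Prop. 5.2 (p. 110)] -/
def resTₗ {W : X.Opens} (h : W ≤ V) :
    letI := tsecModuleSelf M N V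
    letI := tsecModuleOfLE M N h
    TSec M N V →ₗ[Γ(X, V)] TSec M N W :=
  letI := tsecModuleSelf M N V
  letI := tsecModuleOfLE M N h
  { toFun := resT M N h
    map_add' := fun x y => map_add ((tensorPresheaf M N).map (homOfLE h).op).hom x y
    map_smul' := fun r x => resT_smul h r x }

/-- `resTₗ` is `resT`. [cite: StacksProject, Tag 01CA] -/
theorem resTₗ_apply {W : X.Opens} (h : W ≤ V) (x : TSec M N V) :
    letI := tsecModuleSelf M N V
    letI := tsecModuleOfLE M N h
    resTₗ M N h x = resT M N h x := rfl

/-- Restriction between two opens below `V` is `Γ(V, 𝒪_X)`-linear for the restricted-scalar structures.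
[cite: StacksProject, Tag 01CA] -/
def resTOfLEₗ {W Y : X.Opens} (hW : W ≤ V) (hY : Y ≤ V) (h : Y ≤ W) :
    letI := tsecModuleOfLE M N hW
    letI := tsecModuleOfLE M N hY
    TSec M N W →ₗ[Γ(X, V)] TSec M N Y :=
  letI := tsecModuleOfLE M N hW
  letI := tsecModuleOfLE M N hY
  { toFun := resT M N h
    map_add' := fun x y => map_add ((tensorPresheaf M N).map (homOfLE h).op).hom x y
    map_smul' := fun r x => by
      change resT M N h (resRing hW r • x) = resRing hY r • resT M N h x
      rw [resT_smul, resRing_resRing] }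

end ModuleOfLE

/-! ### §2 `M(D(g)) ⊗_{𝒪(D(g))} N(D(g))` is the localization of `M(V) ⊗_{𝒪(V)} N(V)` at `g` -/

section Localization

variable {M N} (hM : IsAffineLocalizing M) (hN : IsAffineLocalizing N) (hV : IsAffineOpen V)
include hM hN hV

/-- **`M(D(g)) ⊗_{A_g} N(D(g)) = (M(V) ⊗_A N(V))_g`** (`A = Γ(V, 𝒪_X)`, `V` affine, `M`, `N` affine-localizing): the
restriction of presheaf tensors `M(V) ⊗_A N(V) → M(D(g)) ⊗_{A_g} N(D(g))` is a localization at the powers of `g`.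
Proof: `M(D(g)) = M(V)_g`, `N(D(g)) = N(V)_g` (Hartshorne II 5.3), a tensor product of localization maps is a
localization map (Mathlib), and `⊗_{A_g} = ⊗_A` on `A_g`-modules (Mathlib `IsLocalization.moduleTensorEquiv`).
[cite: Hartshorne1977, II Prop. 5.2 (b) (p. 110)] [cite: StacksProject, Tag 01I8] -/
theorem isLocalizedModule_resTₗ (g : Γ(X, V)) :
    letI := tsecModuleSelf M N V
    letI := tsecModuleOfLE M N (X.basicOpen_le g)
    IsLocalizedModule (Submonoid.powers g) (resTₗ M N (X.basicOpen_le g)) := by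
  letI := tsecModuleSelf M N V
  letI := tsecModuleOfLE M N (X.basicOpen_le g)
  -- the `A`-module structures on `M(D(g))`, `N(D(g))` by restriction of scalars (`Modules/FiniteTypeLocal`)
  letI iM : Module Γ(X, V) Γ(M, X.basicOpen g) := moduleBasicOpen M g
  letI iN : Module Γ(X, V) Γ(N, X.basicOpen g) := moduleBasicOpen N g
  haveI := hV.isLocalization_basicOpen g
  haveI hM' : IsLocalizedModule (Submonoid.powers g) (resBasicOpen M g) := hM.isLocalizedModule_basicOpen g hV
  haveI hN' : IsLocalizedModule (Submonoid.powers g) (resBasicOpen N g) := hN.isLocalizedModule_basicOpen g hV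
  -- `M(V)_g ⊗_A N(V)_g` is the localization of `M(V) ⊗_A N(V)` (Mathlib)
  haveI hT : IsLocalizedModule (Submonoid.powers g) (TensorProduct.map (resBasicOpen M g) (resBasicOpen N g)) :=
    inferInstance
  -- `⊗_{A_g} = ⊗_A` on `A_g`-modules (Mathlib), as an `A`-linear equivalence onto `M(D(g)) ⊗_{A_g} N(D(g))` with
  -- its restricted-scalar structure
  let e₀ : Γ(M, X.basicOpen g) ⊗[Γ(X, X.basicOpen g)] Γ(N, X.basicOpen g) ≃ₗ[Γ(X, X.basicOpen g)]
      Γ(M, X.basicOpen g) ⊗[Γ(X, V)] Γ(N, X.basicOpen g) :=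
    IsLocalization.moduleTensorEquiv (Submonoid.powers g) Γ(X, X.basicOpen g)
      Γ(M, X.basicOpen g) Γ(N, X.basicOpen g)
  let e : (Γ(M, X.basicOpen g) ⊗[Γ(X, V)] Γ(N, X.basicOpen g)) ≃ₗ[Γ(X, V)] TSec M N (X.basicOpen g) :=
    { toFun := fun x => (e₀.symm x : Γ(M, X.basicOpen g) ⊗[Γ(X, X.basicOpen g)] Γ(N, X.basicOpen g))
      invFun := fun y => e₀ y
      map_add' := fun x y => map_add e₀.symm x y
      map_smul' := fun r x => by
        change e₀.symm (r • x) = X.presheaf.map (homOfLE (X.basicOpen_le g)).op r • e₀.symm x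
        rw [← e₀.symm.map_smul]
        congr 1
      left_inv := fun x => e₀.apply_symm_apply x
      right_inv := fun x => e₀.symm_apply_apply x }
  have he : ∀ (m : Γ(M, X.basicOpen g)) (n' : Γ(N, X.basicOpen g)),
      e (m ⊗ₜ n') = (m ⊗ₜ[Γ(X, X.basicOpen g)] n' : TSec M N (X.basicOpen g)) := by
    intro m n'
    change e₀.symm (m ⊗ₜ n') = m ⊗ₜ n'
    rw [LinearEquiv.symm_apply_eq]
    rfl
  -- the composite is `resT`
  have hcomp : (e : _ →ₗ[Γ(X, V)] _) ∘ₗ TensorProduct.map (resBasicOpen M g) (resBasicOpen N g) =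
      resTₗ M N (X.basicOpen_le g) := by
    apply TensorProduct.ext'
    intro m n'
    change e (resBasicOpen M g m ⊗ₜ resBasicOpen N g n') = resT M N (X.basicOpen_le g) (m ⊗ₜ n')
    exact (he _ _).trans (resT_tmul (X.basicOpen_le g) m n').symm
  rw [← hcomp]
  exact IsLocalizedModule.of_linearEquiv (Submonoid.powers g) _ e

end Localization

/-! ### §3 The presheaf tensors over the standard opens of a finite family form a localizing system -/

section System

variable {A : Type u} (g : A → Γ(X, V))

/-- The `Γ(V, 𝒪_X)`-module structures on the presheaf tensors over the standard opens, as a family (bound with `letI`).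
[cite: Hartshorne1977, II Prop. 5.2 (p. 110)] -/
@[reducible]
def sysModule : ∀ (m : ℕ) (k : Fin (m + 1) → A), Module Γ(X, V) (TSec M N (PCech.sysOpen g k)) :=
  fun _ k => tsecModuleOfLE M N (PCech.sysOpen_le g k)

/-- The structure maps of the localizing system: restriction `M(V) ⊗ N(V) → M(D(g_k)) ⊗ N(D(g_k))`.
[cite: StacksProject, Tag 00EK] -/
def sysι : letI := tsecModuleSelf M N V
    letI := sysModule M N g
    ∀ (m : ℕ) (k : Fin (m + 1) → A), TSec M N V →ₗ[Γ(X, V)] TSec M N (PCech.sysOpen g k) :=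
  fun _ k => resTₗ M N (PCech.sysOpen_le g k)

variable {M N}

/-- **The presheaf tensors over the standard opens of `(g_a)` form a localizing system** over `Γ(V, 𝒪_X)` when `V` is
affine and `M`, `N` are affine-localizing. [cite: StacksProject, Tag 00EK] [cite: Hartshorne1977, II Prop. 5.2 (b) (p. 110)] -/
theorem isSystem_tsec (hM : IsAffineLocalizing M) (hN : IsAffineLocalizing N) (hV : IsAffineOpen V) :
    letI := tsecModuleSelf M N V
    letI := sysModule M N g
    CechLocalization.IsSystem g 1 (fun _ k => TSec M N (PCech.sysOpen g k)) (sysι M N g) := by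
  letI := tsecModuleSelf M N V
  letI := sysModule M N g
  refine ⟨fun m k => ?_⟩
  have e : CechLocalization.pw g 1 k = Submonoid.powers (CechLocalization.gprod g k) := by
    rw [CechLocalization.pw, one_mul]
  rw [e]
  exact isLocalizedModule_resTₗ hM hN hV (CechLocalization.gprod g k)

/-- The face maps of the localizing system of presheaf tensors are restrictions. [cite: StacksProject, Tag 00EK] -/
theorem face_tsec_apply (hM : IsAffineLocalizing M) (hN : IsAffineLocalizing N) (hV : IsAffineOpen V) {m : ℕ}
    (k : Fin (m + 2) → A) (i : Fin (m + 2)) (y : TSec M N (PCech.sysOpen g (CechLocalization.faceIdx k i))) :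
    letI := tsecModuleSelf M N V
    letI := sysModule M N g
    CechLocalization.face (isSystem_tsec g hM hN hV) k i y = resT M N (PCech.sysOpen_le_sysOpen_faceIdx g k i) y := by
  letI := tsecModuleSelf M N V
  letI := sysModule M N g
  have hu := CechLocalization.transfer_unique (isSystem_tsec g hM hN hV) (CechLocalization.faceIdx k i) k
    (CechLocalization.isUnit_face (isSystem_tsec g hM hN hV) k i)
    (resTOfLEₗ M N (PCech.sysOpen_le g _) (PCech.sysOpen_le g k) (PCech.sysOpen_le_sysOpen_faceIdx g k i))
    (LinearMap.ext fun x => resT_resT M N _ _ x)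
  exact (LinearMap.congr_fun hu y).symm

/-- **Separation (Stacks 00EK, injectivity half)**: a presheaf tensor over `V` whose restrictions to the `D(g_a)` vanish
is zero, when the `g_a` generate the unit ideal, `A` is finite, `V` is affine and `M`, `N` are affine-localizing.
[cite: StacksProject, Tag 00EK] [cite: Hartshorne1977, II Prop. 5.1 (p. 110)] -/
theorem tsec_eq_zero_of_forall_resT [Finite A] (hM : IsAffineLocalizing M) (hN : IsAffineLocalizing N)
    (hV : IsAffineOpen V) (hg : Ideal.span (Set.range g) = ⊤) (x : TSec M N V)
    (hx : ∀ a, resT M N (X.basicOpen_le (g a)) x = 0) : x = 0 := by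
  letI := tsecModuleSelf M N V
  letI := sysModule M N g
  refine CechLocalization.eq_zero_of_forall_ι_eq_zero hg (isSystem_tsec g hM hN hV) fun k => ?_
  have hle : PCech.sysOpen g k ≤ X.basicOpen (g (k 0)) := le_of_eq (by rw [PCech.sysOpen, Fin.prod_univ_one])
  change resT M N (PCech.sysOpen_le g k) x = 0
  rw [← resT_resT M N (X.basicOpen_le (g (k 0))) hle, hx, resT_zero]

/-- **Gluing (Stacks 00EK, `Ȟ⁰ = M`)**: presheaf tensors over the `D(g_a)` which agree on the `D(g_a g_b)` come from one
presheaf tensor over `V`, when the `g_a` generate the unit ideal, `A` is finite, `V` is affine and `M`, `N` are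
affine-localizing. [cite: StacksProject, Tag 00EK] [cite: Hartshorne1977, II Prop. 5.1 (p. 110)] -/
theorem exists_tsec_of_compatible [Finite A] (hM : IsAffineLocalizing M) (hN : IsAffineLocalizing N)
    (hV : IsAffineOpen V) (hg : Ideal.span (Set.range g) = ⊤) (c : ∀ a, TSec M N (X.basicOpen (g a)))
    (hc : ∀ a b, resT M N (W := X.basicOpen (g a * g b)) (by rw [Scheme.basicOpen_mul]; exact inf_le_left) (c a) =
      resT M N (W := X.basicOpen (g a * g b)) (by rw [Scheme.basicOpen_mul]; exact inf_le_right) (c b)) :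
    ∃ x : TSec M N V, ∀ a, resT M N (X.basicOpen_le (g a)) x = c a := by
  letI := tsecModuleSelf M N V
  letI := sysModule M N g
  have hL := isSystem_tsec g hM hN hV
  have e₁ : ∀ k : Fin 1 → A, PCech.sysOpen g k = X.basicOpen (g (k 0)) := fun k => by
    rw [PCech.sysOpen, Fin.prod_univ_one]
  let s : CechLocalization.Cochain (fun _ k => TSec M N (PCech.sysOpen g k)) 0 :=
    fun k => resT M N (le_of_eq (e₁ k)) (c (k 0))
  have key : ∀ {m : ℕ} (k' : Fin (m + 1) → A) (k₁ : Fin 1 → A) (hk : PCech.sysOpen g k' ≤ PCech.sysOpen g k₁),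
      resT M N hk (s k₁) = resT M N (hk.trans (le_of_eq (e₁ k₁))) (c (k₁ 0)) :=
    fun k' k₁ hk => resT_resT M N _ _ _
  have hs : CechLocalization.cechD hL 0 s = 0 := by
    funext k'
    rw [CechLocalization.cechD_apply, Fin.sum_univ_two, face_tsec_apply g hM hN hV, face_tsec_apply g hM hN hV,
      key, key]
    have e0 : CechLocalization.faceIdx k' 0 0 = k' 1 := rfl
    have e1' : CechLocalization.faceIdx k' 1 0 = k' 0 := rfl
    have h2 : PCech.sysOpen g k' =
        X.basicOpen (g (CechLocalization.faceIdx k' 1 0) * g (CechLocalization.faceIdx k' 0 0)) := by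
      rw [e0, e1', PCech.sysOpen, Fin.prod_univ_two]
    have hc' := hc (CechLocalization.faceIdx k' 1 0) (CechLocalization.faceIdx k' 0 0)
    have t₀ : resT M N ((PCech.sysOpen_le_sysOpen_faceIdx g k' 0).trans (le_of_eq (e₁ _)))
        (c (CechLocalization.faceIdx k' 0 0)) =
        resT M N (le_of_eq h2) (resT M N (W := X.basicOpen (g _ * g _))
          (by rw [Scheme.basicOpen_mul]; exact inf_le_right) (c (CechLocalization.faceIdx k' 0 0))) :=
      (resT_resT M N _ _ _).symm
    have t₁ : resT M N ((PCech.sysOpen_le_sysOpen_faceIdx g k' 1).trans (le_of_eq (e₁ _)))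
        (c (CechLocalization.faceIdx k' 1 0)) =
        resT M N (le_of_eq h2) (resT M N (W := X.basicOpen (g _ * g _))
          (by rw [Scheme.basicOpen_mul]; exact inf_le_left) (c (CechLocalization.faceIdx k' 1 0))) :=
      (resT_resT M N _ _ _).symm
    rw [t₀, t₁, hc']
    simp
  obtain ⟨r, hr⟩ := CechLocalization.exists_eq_ι_of_cechD_eq_zero hg hL s hs
  refine ⟨r, fun a => resT_injective_of_eq M N (e₁ (CechLocalization.single a)) ?_⟩
  exact (resT_resT M N _ _ r).trans (hr (CechLocalization.single a))

end System

end Literature.AlgebraicGeometry.Modules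

end
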